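import Summits.Ventures.PercRepro.CatLocal

/-!
# Branch catalogues — the within-part H-graph is local (module 3)

In mode `μ`, the within-part H-step of the branch `b` (`HAdjIn` of `HJoin`, which mentions the
global cluster of `c`) is the local H-step `hadjLoc` (`hAdjIn_iff_loc`), and within-part H-walks
avoiding the cluster of a mark are the local H-walks `hconnAvoidLoc` (`hConnAvoidIn_iff_loc`);
so the detour fact of a pair of terminals through the branch `b` is `Dloc` of its state.
-/

namespace PercRepro.CatGraph

open MultiGraph StarGadgetGraph

variable {C : Type} {BV BE : C → Type} {m : C → ℕ} (loc : ∀ τ, MultiGraph (Fin 4 ⊕ BV τ) (BE τ))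

/-- The avoided vertex set: nothing, or the open cluster of the mark `m'`. -/
def Xset (S : Config (CE BE m)) : Option (Fin 3) → Set (CV BV m)
  | none => ∅
  | some m' => (catGadget loc m).cluster S (vm m')

/-- A local vertex avoids `X` iff `inXLoc` fails. -/
theorem not_mem_Xset_iff_loc {μ : Mode} {S : Config (CE BE m)} (hμ : InMode loc μ S)
    (X : Option (Fin 3)) (b : Br m) (v : Fin 4 ⊕ BV b.1) :
    emb b v ∉ Xset loc S X ↔ ¬ inXLoc loc μ b.1 X (brState S b) v := by
  rcases X with _ | m'
  · simp [Xset, inXLoc]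
  · simp only [Xset, inXLoc, Option.some.injEq, exists_eq_left']
    rw [mem_cluster_vm_iff_loc loc hμ]

/-- `Xset` is closed under connectivity. -/
theorem xset_closed (S : Config (CE BE m)) (X : Option (Fin 3)) :
    ∀ u v, u ∉ Xset loc S X → (catGadget loc m).Conn S u v → v ∉ Xset loc S X := by
  rcases X with _ | m'
  · simp [Xset]
  · intro u v hu huv hv
    exact hu ((hv : (catGadget loc m).Conn S (vm m') v).trans huv.symm)

/-- The edges of the branch `b` joining two local vertices, with a predicate. -/
theorem exists_edge_iff_loc (b : Br m) (Q : CE BE m → Prop)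
    (u v : Fin 4 ⊕ BV b.1) :
    (∃ e, pe e = some b ∧ Q e ∧ (catGadget loc m).Joins e (emb b u) (emb b v)) ↔
      ∃ e : BE b.1, Q ⟨b, e⟩ ∧ (loc b.1).Joins e u v := by
  constructor
  · rintro ⟨⟨b', e⟩, hb, hQ, hj⟩
    rw [pe_eq_some_iff] at hb
    subst hb
    exact ⟨e, hQ, (joins_iff_loc loc b' e u v).1 hj⟩
  · rintro ⟨e, hQ, hj⟩
    exact ⟨⟨b, e⟩, rfl, hQ, (joins_iff_loc loc b e u v).2 hj⟩

/-- **The within-part H-step is local.** -/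
theorem hAdjIn_iff_loc {μ : Mode} {S : Config (CE BE m)} (hμ : InMode loc μ S) (b : Br m)
    (u v : Fin 4 ⊕ BV b.1) :
    (catGadget loc m).HAdjIn S (vm 2) pe (some b) (emb b u) (emb b v) ↔
      hadjLoc loc μ b.1 (brState S b) u v := by
  unfold HAdjIn hadjLoc
  rw [mem_cluster_vm_iff_loc loc hμ 2 b u, mem_cluster_vm_iff_loc loc hμ 2 b v,
    connIn_iff_loc loc S b u v]
  have e1 : (∃ e, pe e = some b ∧ S e = false ∧ (catGadget loc m).Joins e (emb b u) (emb b v)) ↔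
      ∃ e, brState S b e = false ∧ (loc b.1).Joins e u v :=
    exists_edge_iff_loc loc b (fun e => S e = false) u v
  have e2 : (∃ e, pe e = some b ∧ (catGadget loc m).Joins e (emb b u) (emb b v)) ↔
      ∃ e, (loc b.1).Joins e u v := by
    have := exists_edge_iff_loc loc b (fun _ => True) u v
    simp only [true_and] at this
    exact this
  rw [e1, e2]

/-- A non-trivial within-part H-step of the branch `b` has both ends in the range of `emb b`. -/
theorem hAdjIn_mem_range (S : Config (CE BE m)) (b : Br m) {x y : CV BV m}
    (h : (catGadget loc m).HAdjIn S (vm 2) pe (some b) x y) (hne : x ≠ y) :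
    x ∈ Set.range (emb b) ∧ y ∈ Set.range (emb b) := by
  rcases h with ⟨-, -, ⟨b', e⟩, hb, -, hj⟩ | ⟨-, ⟨b', e⟩, hb, hj⟩ | ⟨-, -, hc⟩
  · rw [pe_eq_some_iff] at hb
    subst hb
    rcases hj with ⟨h1, h2⟩ | ⟨h1, h2⟩
    · exact ⟨⟨_, h1⟩, ⟨_, h2⟩⟩
    · exact ⟨⟨_, h2⟩, ⟨_, h1⟩⟩
  · rw [pe_eq_some_iff] at hb
    subst hb
    rcases hj with ⟨h1, h2⟩ | ⟨h1, h2⟩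
    · exact ⟨⟨_, h1⟩, ⟨_, h2⟩⟩
    · exact ⟨⟨_, h2⟩, ⟨_, h1⟩⟩
  · -- a non-trivial within-part walk: its first and last steps are branch edges
    unfold ConnIn at hc
    have hx : x ∈ Set.range (emb b) := by
      rcases Relation.ReflTransGen.cases_head hc with h | ⟨z, hxz, -⟩
      · exact absurd h hne
      · exact (openAdjIn_mem_range loc S b hxz).1
    have hy : y ∈ Set.range (emb b) := by
      rcases Relation.ReflTransGen.cases_tail hc with h | ⟨z, -, hzy⟩
      · exact absurd h.symm hne
      · exact (openAdjIn_mem_range loc S b hzy).2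
    exact ⟨hx, hy⟩

/-- **Within-part H-walks avoiding the cluster of a mark are local.** -/
theorem hConnAvoidIn_iff_loc {μ : Mode} {S : Config (CE BE m)} (hμ : InMode loc μ S)
    (X : Option (Fin 3)) (b : Br m) (u v : Fin 4 ⊕ BV b.1) :
    (catGadget loc m).HConnAvoidIn S (vm 2) pe (some b) (Xset loc S X) (emb b u) (emb b v) ↔
      hconnAvoidLoc loc μ b.1 X (brState S b) u v := by
  unfold HConnAvoidIn hconnAvoidLoc
  rw [reflTransGen_comap_iff' (emb b) (emb_injective b) _
    (fun x y hxy hne => hAdjIn_mem_range loc S b hxy.1 hne)]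
  constructor
  · intro h
    induction h with
    | refl => exact Relation.ReflTransGen.refl
    | tail _ hxy ih =>
      exact ih.tail ⟨(hAdjIn_iff_loc loc hμ b _ _).1 hxy.1,
        (not_mem_Xset_iff_loc loc hμ X b _).1 hxy.2.1, (not_mem_Xset_iff_loc loc hμ X b _).1 hxy.2.2⟩
  · intro h
    induction h with
    | refl => exact Relation.ReflTransGen.refl
    | tail _ hxy ih =>
      exact ih.tail ⟨(hAdjIn_iff_loc loc hμ b _ _).2 hxy.1,
        (not_mem_Xset_iff_loc loc hμ X b _).2 hxy.2.1, (not_mem_Xset_iff_loc loc hμ X b _).2 hxy.2.2⟩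

/-- **The detour fact through the branch `b` is `Dloc` of its state.** -/
theorem hConnAvoidIn_cen_iff_Dloc {μ : Mode} {S : Config (CE BE m)} (hμ : InMode loc μ S)
    (X : Option (Fin 3)) (b : Br m) (i j : Fin 4) :
    (catGadget loc m).HConnAvoidIn S (vm 2) pe (some b) (Xset loc S X) (cen i) (cen j) ↔
      Dloc loc μ b.1 X i j (brState S b) :=
  hConnAvoidIn_iff_loc loc hμ X b (.inl i) (.inl j)

/-- Nothing is H-connected through the part `none` (no edge has part `none`; the third disjunct
needs a within-part walk, which is trivial). -/
theorem hAdjIn_none_iff (S : Config (CE BE m)) (u v : CV BV m) :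
    (catGadget loc m).HAdjIn S (vm 2) pe none u v ↔
      u = v ∧ u ∉ (catGadget loc m).cluster S (vm 2) := by
  unfold HAdjIn
  constructor
  · rintro (⟨-, -, e, he, -⟩ | ⟨-, e, he, -⟩ | ⟨hu, -, hc⟩)
    · cases he
    · cases he
    · exact ⟨(connIn_none_iff loc S u v).1 hc, hu⟩
  · rintro ⟨rfl, hu⟩
    exact Or.inr (Or.inr ⟨hu, hu, (connIn_none_iff loc S u u).2 rfl⟩)

end PercRepro.CatGraph
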